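import Mathlib
import Literature.NumberTheory.LFunctions.Zhang2022.AppendixAXiZeroMult
import Literature.NumberTheory.LFunctions.Zhang2022.AppendixALemma83Generic
import Literature.NumberTheory.LFunctions.Zhang2022.TypedAppendixA1
import Literature.NumberTheory.Sieve.DivisorBound
import HarnessLib

/-!
# Zhang (2022), App. A p. 101 (§A.u004, prefactor-free reading): the Euler product
# `𝒰_j(d,h;s) = ∏_q 𝔱_j(d,h,s;q)` for `σ > 1` — `Typed.AppendixA1.StepA_u004_read` PROVED

Topic `Literature/NumberTheory/LFunctions/Zhang2022` (Landau–Siegel audit tree; verdict-neutral).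
Y. Zhang, *Discrete mean estimates and the Landau–Siegel zero*, arXiv:2211.02515v1 (2022)
[Zhang2022LandauSiegel] — **an unrefereed manuscript under adjudication; nothing here asserts or denies
its Theorems 1–2.** ZHANG-L discharge lane (WP09). The typed node `Typed.AppendixA1.StepA_u004_read c′`
(App. A p. 101, tex L4982–4986, the PREFACTOR-FREE reading of the display §A.u004 recorded by the typer,
flag F2; rows G-L4t8-1 / G-d55-1) says: for `σ > 1`,

  `𝒰_j(d,h;s) = L(s,χ)/(L(s+β_{j+1},χ)L(s+β_{j+2},χ)) · Σ_m χ(m)ξ₀ⱼ(m;d,h)m^{−s} = ∏_q 𝔱_j(d,h,s;q)`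

as `HasProd (q ↦ frakt c′ χ j d h s q) (calU c′ χ j d h s)` over `Nat.Primes`. **This file proves it**
(`Typed.AppendixA1.stepA_u004_read_holds : ∀ c′, StepA_u004_read c′`; indeed for EVERY `D`, `χ`, `j`,
`d, h ≥ 1` and `σ > 1` — `hasProd_frakt_calU` — no largeness, no Assumption (A), no `dh < PT⁻²`).
It is the `σ > 1` identification input of the two App. A leaves `StepA_u007_analytic` / `StepA_u007_read`
of `Skeleton.theorem1_of_leaves_v19` (the analytic continuation `U` of `𝒰_j` is `∏'_q 𝔱_j`).

Proof (the manuscript's implicit one-liner, with absolute convergence made explicit; architecture =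
the §15 twin `TypedSection15BEuler` + `Section15BCalM1Identity` for `𝓜₁`):
* §1 `‖ξ₀ⱼ(q^e;d,r)‖ ≤ 1806(e+1)³` at every prime power (Cases 1–3 of App. A in exact form,
  `AppendixALemma83Local`, `AppendixALemma83Generic.norm_xiA_prime_pow_le`, `|λ̃| ≤ 7`), hence by
  multiplicativity (`AppendixAXiZeroMult.xiZero_mul_of_coprime`) `‖ξ₀ⱼ(n;d,r)‖ ≤ 1806^{ω(n)}τ(n)³ ≤ τ(n)^t`
  and `Σ_n χ(n)ξ₀ⱼ(n;d,r)n^{−s}` converges absolutely for `σ > 1` (divisor bound `τ(n) ≪_ε n^ε`);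
* §2 Mathlib's `EulerProduct.eulerProduct_hasProd` for the multiplicative `n ↦ χ(n)ξ₀ⱼ(n;d,h)n^{−s}`, whose
  local factor is `1 + λ̃(q,dh;1−β_j)·Σ_{r≥1} χ(q^r)ξ_j(q^r;d,h)q^{−rs} = 1 + λ̃·xiPowSum`
  (`λ̃₀ⱼ(q^r,dh) = λ̃(q,dh;1−β_j)`, `ξ₀ⱼ = λ̃₀ⱼ·ξ_j`);
* §3 the Euler products of `L(s,χ)`, `L(s+β_{j+1},χ)⁻¹`, `L(s+β_{j+2},χ)⁻¹` (Mathlib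
  `DirichletCharacter.LSeries_eulerProduct_hasProd`, nonvanishing for `σ > 1`) give `∏_q pref = L/(LL)`,
  and `HasProd.mul` assembles `∏_q 𝔱_j = 𝒰_j`.

Theorems only; no definitions, no new facts.

## References

* Y. Zhang, arXiv:2211.02515v1 (2022), App. A p. 101 (tex L4982–4988); §7 p. 33; §8 Lemma 8.3 p. 46.
  [cite: Zhang2022LandauSiegel, App. A p.101]
* G. H. Hardy, E. M. Wright, *An Introduction to the Theory of Numbers*, Thm 315 (divisor bound). [folklore]
-/

noncomputable section

open Complex Real Finset Filter Topology

namespace Literature.NumberTheory.LFunctions.Zhang2022.Lemma83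

open Literature.NumberTheory.LFunctions.Zhang2022
open Literature.NumberTheory.LFunctions.Zhang2022.Skeleton
open Literature.NumberTheory.LFunctions.Zhang2022.MeanSquareMajorant
open Literature.NumberTheory.LFunctions.Zhang2022.Typed.AppendixA1

/-! ## §0. Folklore on `ω`, `τ` -/

section Folklore

/-- `2^{ω(n)} ≤ τ(n)` (`n ≥ 1`). [folklore] -/
private theorem two_pow_card_primeFactors_le_card_divisors {n : ℕ} (hn : n ≠ 0) :
    2 ^ n.primeFactors.card ≤ n.divisors.card := by
  rw [Nat.card_divisors hn]
  refine Finset.pow_card_le_prod _ _ _ fun p hp => ?_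
  have : 0 < n.factorization p := Nat.Prime.factorization_pos_of_dvd (Nat.prime_of_mem_primeFactors hp)
    hn (Nat.dvd_of_mem_primeFactors hp)
  omega

/-- `1 ≤ τ(n)` for `n ≥ 1`. [folklore] -/
private theorem one_le_card_divisors {n : ℕ} (hn : n ≠ 0) : 1 ≤ n.divisors.card :=
  Finset.card_pos.mpr ⟨1, Nat.one_mem_divisors.mpr hn⟩

/-- `A^{ω(n)} ≤ τ(n)^{log₂ A}` for `A ≥ 1`, `n ≥ 1`. [folklore] -/
private theorem pow_card_primeFactors_le_rpow_card_divisors {A : ℝ} (hA : 1 ≤ A) {n : ℕ} (hn : n ≠ 0) :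
    A ^ n.primeFactors.card ≤ (n.divisors.card : ℝ) ^ Real.logb 2 A := by
  have hA0 : 0 < A := one_pos.trans_le hA
  have ht : 0 ≤ Real.logb 2 A := Real.logb_nonneg one_lt_two hA
  have h2 : (2 : ℝ) ^ (n.primeFactors.card : ℝ) ≤ (n.divisors.card : ℝ) := by
    rw [Real.rpow_natCast]
    exact_mod_cast two_pow_card_primeFactors_le_card_divisors hn
  have hA2 : A = (2 : ℝ) ^ Real.logb 2 A := (Real.rpow_logb two_pos (by norm_num) hA0).symm
  calc A ^ n.primeFactors.card = ((2 : ℝ) ^ Real.logb 2 A) ^ (n.primeFactors.card : ℝ) := by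
        rw [Real.rpow_natCast, ← hA2]
    _ = ((2 : ℝ) ^ (n.primeFactors.card : ℝ)) ^ Real.logb 2 A := by
        rw [← Real.rpow_mul zero_le_two, mul_comm, Real.rpow_mul zero_le_two]
    _ ≤ (n.divisors.card : ℝ) ^ Real.logb 2 A :=
        Real.rpow_le_rpow (by positivity) h2 ht

end Folklore

/-! ## §1. Majorants for `ξ₀ⱼ(n;d,r)` -/

section Majorants

variable (c' : ℝ) (D : ℕ) (j : ℕ)

/-- `λ̃₀ⱼ(q^e, M) = λ̃(q, M; 1−β_j)` for a prime power `q^e`, `e ≥ 1` (both are the single `λ`-factor at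
`q` if `(q,M) = 1`, and `1` otherwise; "`λ̃(q^r,k;s) = λ̃(q,k;s)`", App. A tex L4982).
[cite: Zhang2022LandauSiegel, App. A p.101] -/
theorem lamTildeZero_prime_pow_eq_lamTilde {q e : ℕ} (hq : q.Prime) (he : e ≠ 0) (M : ℕ) :
    lamTildeZero c' D j (q ^ e) M = lamTilde c' D q M (1 - betaJ c' D j) := by
  rw [lamTildeZero_prime_pow c' D hq he]
  by_cases hc : Nat.Coprime q M
  · rw [if_pos hc, lamTilde_prime_eq c' D hq hc, lamZero, lam, hq.primeFactors, Finset.prod_singleton]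
  · rw [if_neg hc]
    unfold lamTilde
    rw [hq.primeFactors, Finset.filter_singleton, if_neg hc, Finset.prod_empty]

/-- `‖λ̃₀ⱼ(q^e, M)‖ ≤ 7` at a prime power (`e ≥ 1`): `≤ 7` if `(q,M) = 1`
(`AppendixALemma83Generic.norm_lamTilde_prime_le`), `= 1` otherwise. [cite: Zhang2022LandauSiegel, App. A p.101] -/
theorem norm_lamTildeZero_prime_pow_le {q e : ℕ} (hq : q.Prime) (he : e ≠ 0) (M : ℕ) :
    ‖lamTildeZero c' D j (q ^ e) M‖ ≤ 7 := by
  rw [lamTildeZero_prime_pow c' D hq he]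
  by_cases hc : Nat.Coprime q M
  · rw [if_pos hc]
    have h := (norm_lamTilde_prime_le c' D j hq (Nat.coprime_one_right q)).1
    rwa [lamTilde_prime_eq c' D hq (Nat.coprime_one_right q), show
      (1 - (q : ℂ) ^ (-(1 - betaJ c' D j + beta1 c' D))) * (1 - (q : ℂ) ^ (-(1 - betaJ c' D j + beta2 c' D))) *
        (1 - (q : ℂ) ^ (-(1 - betaJ c' D j + beta3 c' D))) / (1 - (q : ℂ) ^ (-(1 - betaJ c' D j))) =
      lamZero c' D j q by rw [lamZero, lam, hq.primeFactors, Finset.prod_singleton]] at h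
  · rw [if_neg hc, norm_one]; norm_num

/-- **`‖ξ₀ⱼ(q^e;d,r)‖ ≤ 1806·(e+1)³` at every prime power** (`e ≥ 1`, `d, r ≥ 1`), uniformly in `q, d, r`:
Case 2 (`q ∣ r`) `ξ₀ⱼ(q^e) = κ(q^e)`, Case 3 (`q ∣ d`, `q ∤ r`) `= κ(q^e) − κ(q^{e−1})q^{1−β_j}/(q−1)`, Case 1
(`q ∤ dr`) `= λ₀ⱼ(q)·ξ_j(q^e;d,r)` with `‖ξ_j(q^e;d,r)‖ ≤ 258(e+1)³`; `|κ(q^m)| ≤ (m+1)³`, `|λ| ≤ 7`.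
[cite: Zhang2022LandauSiegel, App. A pp.102–103] -/
theorem norm_xiZero_prime_pow_le {q e : ℕ} (hq : q.Prime) (he : e ≠ 0) (d r : ℕ) :
    ‖xiZero c' D j (q ^ e) d r‖ ≤ 1806 * ((e : ℝ) + 1) ^ 3 := by
  have hκ : ∀ m : ℕ, ‖kappaZ c' D (q ^ m)‖ ≤ ((m : ℝ) + 1) ^ 3 := fun m =>
    norm_kappa_prime_pow_le (b1 c' D) (b2 c' D) (b3 c' D) hq m
  have he3 : (1 : ℝ) ≤ ((e : ℝ) + 1) ^ 3 := one_le_pow₀ (by linarith [Nat.cast_nonneg (α := ℝ) e])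
  by_cases hqr : q ∣ r
  · rw [xiZero_prime_pow_of_dvd_right c' D j hq he hqr]
    calc ‖kappaZ c' D (q ^ e)‖ ≤ ((e : ℝ) + 1) ^ 3 := hκ e
      _ ≤ 1806 * ((e : ℝ) + 1) ^ 3 := by nlinarith
  by_cases hqd : q ∣ d
  · rw [xiZero_prime_pow_of_dvd_left c' D j hq he hqd hqr]
    obtain ⟨hfrac, -, -⟩ := cpow_one_sub_betaJ_div c' D j hq
    have hκ' : ‖kappaZ c' D (q ^ (e - 1))‖ ≤ ((e : ℝ) + 1) ^ 3 := by
      refine (hκ (e - 1)).trans (pow_le_pow_left₀ (by positivity) ?_ 3)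
      have : ((e - 1 : ℕ) : ℝ) ≤ e := by exact_mod_cast Nat.sub_le e 1
      linarith
    calc _ ≤ ‖kappaZ c' D (q ^ e)‖ + ‖kappaZ c' D (q ^ (e - 1)) * (q : ℂ) ^ (1 - betaJ c' D j) / ((q : ℂ) - 1)‖ :=
          norm_sub_le _ _
      _ ≤ ((e : ℝ) + 1) ^ 3 + ((e : ℝ) + 1) ^ 3 * 2 := by
          rw [mul_div_assoc, norm_mul]
          exact add_le_add (hκ e) (mul_le_mul hκ' hfrac (norm_nonneg _) (by positivity))
      _ ≤ 1806 * ((e : ℝ) + 1) ^ 3 := by nlinarith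
  · -- Case 1: `ξ₀ⱼ = λ̃₀ⱼ · ξ_j`
    rw [xiZero_eq c' D j (q ^ e) d r, norm_mul]
    have h1 := norm_lamTildeZero_prime_pow_le c' D j hq he (d * r)
    have h2 := norm_xiA_prime_pow_le c' D j hq hqd hqr (Nat.one_le_iff_ne_zero.mpr he)
    calc ‖lamTildeZero c' D j (q ^ e) (d * r)‖ * ‖xiA c' D j (q ^ e) d r‖
        ≤ 7 * (258 * ((e : ℝ) + 1) ^ 3) := mul_le_mul h1 h2 (norm_nonneg _) (by norm_num)
      _ = 1806 * ((e : ℝ) + 1) ^ 3 := by ring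

/-- **`‖ξ₀ⱼ(n;d,r)‖ ≤ 1806^{ω(n)}·τ(n)³`** (`n, d, r ≥ 1`): multiplicativity
(`AppendixAXiZeroMult.xiZero_mul_of_coprime`) and the prime-power bound. [cite: Zhang2022LandauSiegel, §7 p.33] -/
theorem norm_xiZero_le {d r : ℕ} (hd : d ≠ 0) (hr : r ≠ 0) {n : ℕ} (hn : n ≠ 0) :
    ‖xiZero c' D j n d r‖ ≤ (1806 : ℝ) ^ n.primeFactors.card * (n.divisors.card : ℝ) ^ 3 := by
  induction n using Nat.recOnPosPrimePosCoprime with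
  | prime_pow p k hp hk =>
    rw [Nat.primeFactors_prime_pow hk.ne' hp, Finset.card_singleton, pow_one,
      Nat.divisors_prime_pow hp, Finset.card_map, Finset.card_range]
    push_cast
    exact norm_xiZero_prime_pow_le c' D j hp hk.ne' d r
  | zero => exact absurd rfl hn
  | one =>
    rw [xiZero_apply_one, Nat.primeFactors_one, Finset.card_empty, pow_zero, Nat.divisors_one,
      Finset.card_singleton]
    simp
  | coprime a b ha hb hab iha ihb =>
    have ha0 : a ≠ 0 := by omega
    have hb0 : b ≠ 0 := by omega
    rw [xiZero_mul_of_coprime c' D j hd hr hab, norm_mul, Nat.Coprime.primeFactors_mul hab,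
      Finset.card_union_of_disjoint hab.disjoint_primeFactors,
      Nat.Coprime.card_divisors_mul hab, Nat.cast_mul]
    calc ‖xiZero c' D j a d r‖ * ‖xiZero c' D j b d r‖
        ≤ ((1806 : ℝ) ^ a.primeFactors.card * (a.divisors.card : ℝ) ^ 3) *
            ((1806 : ℝ) ^ b.primeFactors.card * (b.divisors.card : ℝ) ^ 3) :=
          mul_le_mul (iha ha0) (ihb hb0) (norm_nonneg _) (by positivity)
      _ = (1806 : ℝ) ^ (a.primeFactors.card + b.primeFactors.card) *
            ((a.divisors.card : ℝ) * (b.divisors.card : ℝ)) ^ 3 := by ring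

/-- **`‖χ(n)ξ₀ⱼ(n;d,r)‖ ≤ τ(n)^{3 + log₂ 1806}`** (`n, d, r ≥ 1`; `|χ| ≤ 1`, `A^{ω(n)} ≤ τ(n)^{log₂ A}`).
[cite: Zhang2022LandauSiegel, §8 Lemma 8.3 p.46] -/
theorem norm_chi_mul_xiZero_le (χ : DirichletCharacter ℂ D) {d r : ℕ} (hd : d ≠ 0) (hr : r ≠ 0)
    {n : ℕ} (hn : n ≠ 0) :
    ‖χ (n : ZMod D) * xiZero c' D j n d r‖ ≤
      (n.divisors.card : ℝ) ^ ((3 : ℝ) + Real.logb 2 1806) := by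
  have hτ1 : (1 : ℝ) ≤ n.divisors.card := by exact_mod_cast one_le_card_divisors hn
  have hτ0 : (0 : ℝ) < n.divisors.card := one_pos.trans_le hτ1
  have hχ : ‖χ (n : ZMod D)‖ ≤ 1 := χ.norm_le_one _
  have h1 := norm_xiZero_le c' D j hd hr hn
  have h2 : (1806 : ℝ) ^ n.primeFactors.card ≤ (n.divisors.card : ℝ) ^ Real.logb 2 1806 :=
    pow_card_primeFactors_le_rpow_card_divisors (by norm_num) hn
  rw [norm_mul]
  calc ‖χ (n : ZMod D)‖ * ‖xiZero c' D j n d r‖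
      ≤ 1 * ((1806 : ℝ) ^ n.primeFactors.card * (n.divisors.card : ℝ) ^ 3) :=
        mul_le_mul hχ h1 (norm_nonneg _) zero_le_one
    _ ≤ (n.divisors.card : ℝ) ^ Real.logb 2 1806 * (n.divisors.card : ℝ) ^ 3 := by
        rw [one_mul]; gcongr
    _ = (n.divisors.card : ℝ) ^ ((3 : ℝ) + Real.logb 2 1806) := by
        rw [Real.rpow_add hτ0, mul_comm]
        congr 1
        exact_mod_cast (Real.rpow_natCast (n.divisors.card : ℝ) 3).symm

/-- **Absolute convergence of `Σ_n χ(n)ξ₀ⱼ(n;d,r)n^{−s}` for `σ > 1`** (`d, r ≥ 1`; the series of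
Lemma 8.3): with `t = 3 + log₂ 1806`, `δ = (σ−1)/2` and the divisor bound `τ(n) ≤ C n^{δ/t}` the terms
are `≤ Cᵗ n^{δ−σ}`, `δ − σ < −1`. [cite: Zhang2022LandauSiegel, §8 Lemma 8.3 p.46] -/
theorem lseriesSummable_chi_mul_xiZero (χ : DirichletCharacter ℂ D) {d r : ℕ} (hd : d ≠ 0)
    (hr : r ≠ 0) {s : ℂ} (hs : 1 < s.re) :
    LSeriesSummable (fun n => χ (n : ZMod D) * xiZero c' D j n d r) s := by
  set t : ℝ := (3 : ℝ) + Real.logb 2 1806 with ht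
  have hlogb : 0 ≤ Real.logb 2 (1806 : ℝ) := Real.logb_nonneg one_lt_two (by norm_num)
  have ht0 : 0 < t := by rw [ht]; linarith
  set δ : ℝ := (s.re - 1) / 2 with hδ
  have hδ0 : 0 < δ := by rw [hδ]; linarith
  obtain ⟨C, hC1, hC⟩ := Literature.NumberTheory.Sieve.exists_card_divisors_le_mul_rpow
    (show 0 < δ / t by positivity)
  have hC0 : 0 ≤ C := zero_le_one.trans hC1
  have hexp : δ - s.re < -1 := by rw [hδ]; linarith
  have hmaj : Summable fun n : ℕ => C ^ t * (n : ℝ) ^ (δ - s.re) :=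
    (Real.summable_nat_rpow.mpr hexp).mul_left _
  refine Summable.of_norm_bounded hmaj fun n => ?_
  rcases eq_or_ne n 0 with rfl | hn
  · simp only [LSeries.term_zero, norm_zero, Nat.cast_zero]
    exact mul_nonneg (Real.rpow_nonneg hC0 t) (Real.rpow_nonneg le_rfl _)
  have hnR : (0 : ℝ) < n := by exact_mod_cast Nat.pos_of_ne_zero hn
  have hτ0 : (0 : ℝ) ≤ n.divisors.card := Nat.cast_nonneg _
  rw [LSeries.term_of_ne_zero hn, norm_div, Complex.norm_natCast_cpow_of_pos (Nat.pos_of_ne_zero hn),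
    div_le_iff₀ (Real.rpow_pos_of_pos hnR _)]
  have hτ : (n.divisors.card : ℝ) ≤ C * (n : ℝ) ^ (δ / t) := hC n hn
  have hτt : (n.divisors.card : ℝ) ^ t ≤ (C * (n : ℝ) ^ (δ / t)) ^ t :=
    Real.rpow_le_rpow hτ0 hτ ht0.le
  calc ‖χ (n : ZMod D) * xiZero c' D j n d r‖ ≤ (n.divisors.card : ℝ) ^ t :=
        norm_chi_mul_xiZero_le c' D j χ hd hr hn
    _ ≤ (C * (n : ℝ) ^ (δ / t)) ^ t := hτt
    _ = C ^ t * (n : ℝ) ^ δ := by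
        rw [Real.mul_rpow hC0 (Real.rpow_nonneg hnR.le _), ← Real.rpow_mul hnR.le,
          div_mul_cancel₀ δ ht0.ne']
    _ = C ^ t * (n : ℝ) ^ (δ - s.re) * (n : ℝ) ^ s.re := by
        rw [mul_assoc, ← Real.rpow_add hnR]; congr 2; ring

end Majorants

/-! ## §2. The Euler product of `Σ_n χ(n)ξ₀ⱼ(n;d,h)n^{−s}` and its local factor -/

section Euler

open scoped LSeries.notation
open LSeries (term)

variable (c' : ℝ) {D : ℕ} (χ : DirichletCharacter ℂ D) (j : ℕ)

/-- `(q^e)^s = (q^s)^e` for naturals `q, e` and complex `s`. [folklore] -/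
private theorem natCast_pow_cpow (q e : ℕ) (s : ℂ) : ((q ^ e : ℕ) : ℂ) ^ s = ((q : ℂ) ^ s) ^ e := by
  induction e with
  | zero => simp
  | succ e ih => rw [pow_succ, Nat.cast_mul, Complex.natCast_mul_natCast_cpow, ih, pow_succ]

/-- The `L`-series term of `χξ₀ⱼ` at `1` is `1`. [cite: Zhang2022LandauSiegel, §8 Lemma 8.3 p.46] -/
private theorem termF_one (d r : ℕ) (s : ℂ) :
    term (fun n => χ (n : ZMod D) * xiZero c' D j n d r) s 1 = 1 := by
  rw [LSeries.term_of_ne_zero one_ne_zero, xiZero_apply_one, Nat.cast_one, Nat.cast_one, map_one,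
    Complex.one_cpow]
  norm_num

/-- The `L`-series terms of `χξ₀ⱼ` are multiplicative on coprime arguments (`d, r ≥ 1`).
[cite: Zhang2022LandauSiegel, §8 Lemma 8.3 p.46] -/
private theorem termF_mul_of_coprime {d r : ℕ} (hd : d ≠ 0) (hr : r ≠ 0) (s : ℂ) {m n : ℕ}
    (hmn : Nat.Coprime m n) :
    term (fun k => χ (k : ZMod D) * xiZero c' D j k d r) s (m * n) =
      term (fun k => χ (k : ZMod D) * xiZero c' D j k d r) s m *
        term (fun k => χ (k : ZMod D) * xiZero c' D j k d r) s n := by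
  rcases eq_or_ne m 0 with rfl | hm
  · simp
  rcases eq_or_ne n 0 with rfl | hn
  · simp
  rw [LSeries.term_of_ne_zero (mul_ne_zero hm hn), LSeries.term_of_ne_zero hm,
    LSeries.term_of_ne_zero hn, xiZero_mul_of_coprime c' D j hd hr hmn,
    Nat.cast_mul, Nat.cast_mul, map_mul, Complex.natCast_mul_natCast_cpow, div_mul_div_comm]
  ring

/-- **Euler product of `Σ_n χ(n)ξ₀ⱼ(n;d,r)n^{−s}`** (`σ > 1`, `d, r ≥ 1`):
`HasProd (q ↦ Σ_e χ(q^e)ξ₀ⱼ(q^e;d,r)q^{−es}) (Σ_n χ(n)ξ₀ⱼ(n;d,r)n^{−s})`.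
[cite: Zhang2022LandauSiegel, App. A p.101] -/
theorem hasProd_chi_xiZero {d r : ℕ} (hd : d ≠ 0) (hr : r ≠ 0) {s : ℂ} (hs : 1 < s.re) :
    HasProd (fun q : Nat.Primes =>
        ∑' e : ℕ, term (fun n => χ (n : ZMod D) * xiZero c' D j n d r) s (q ^ e))
      (∑' n : ℕ, term (fun n => χ (n : ZMod D) * xiZero c' D j n d r) s n) :=
  EulerProduct.eulerProduct_hasProd (termF_one c' χ j d r s)
    (fun hmn => termF_mul_of_coprime c' χ j hd hr s hmn)
    (lseriesSummable_chi_mul_xiZero c' D j χ hd hr hs).norm (LSeries.term_zero _ _)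

/-- **The local factor**: for a prime `q`, `σ > 1`, `d, h ≥ 1`,
`Σ_e χ(q^e)ξ₀ⱼ(q^e;d,h)q^{−es} = 1 + λ̃(q,dh;1−β_j)·Σ_{r≥1} χ(q^r)ξ_j(q^r;d,h)q^{−rs}`
(`ξ₀ⱼ(q^r;d,h) = λ̃₀ⱼ(q^r,dh)ξ_j(q^r;d,h)`, `λ̃₀ⱼ(q^r,dh) = λ̃(q,dh;1−β_j)` for `r ≥ 1`; the right side is
`1 + lamTilde·xiPowSum`, the second factor of `𝔱_j(d,h,s;q)`). [cite: Zhang2022LandauSiegel, App. A p.101] -/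
theorem tsum_termF_prime_pow {d h : ℕ} (hd : d ≠ 0) (hh : h ≠ 0) {s : ℂ} (hs : 1 < s.re) {q : ℕ}
    (hq : q.Prime) :
    ∑' e : ℕ, term (fun n => χ (n : ZMod D) * xiZero c' D j n d h) s (q ^ e) =
      1 + lamTilde c' D q (d * h) (1 - betaJ c' D j) * xiPowSum c' χ j d h s q := by
  set G : ℕ → ℂ := fun e => term (fun n => χ (n : ZMod D) * xiZero c' D j n d h) s (q ^ e) with hG
  have hGsum : Summable G :=
    (lseriesSummable_chi_mul_xiZero c' D j χ hd hh hs).comp_injective (Nat.pow_right_injective hq.two_le)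
  have hG0 : G 0 = 1 := by simp only [hG, pow_zero]; exact termF_one c' χ j d h s
  have hGe : ∀ r : ℕ, G (r + 1) = lamTilde c' D q (d * h) (1 - betaJ c' D j) *
      (χ ((q ^ (r + 1) : ℕ) : ZMod D) * xiA c' D j (q ^ (r + 1)) d h /
        (q : ℂ) ^ (((r + 1 : ℕ) : ℂ) * s)) := by
    intro r
    simp only [hG]
    rw [LSeries.term_of_ne_zero (pow_ne_zero _ hq.ne_zero), xiZero_eq c' D j (q ^ (r + 1)) d h,
      lamTildeZero_prime_pow_eq_lamTilde c' D j hq (Nat.succ_ne_zero r), natCast_pow_cpow,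
      Complex.cpow_nat_mul]
    ring
  rw [hGsum.tsum_eq_zero_add, hG0]
  congr 1
  unfold xiPowSum
  rw [← tsum_mul_left]
  exact tsum_congr fun r => hGe r

end Euler

/-! ## §3. The prefactor `∏_q pref = L(s,χ)/(L(s+β_{j+1},χ)L(s+β_{j+2},χ))` and the assembly -/

section Assembly

open scoped LSeries.notation
open LSeries (term)

variable (c' : ℝ) {D : ℕ} [NeZero D] (χ : DirichletCharacter ℂ D) (j : ℕ)

/-- An Euler product with nonvanishing value may be inverted factorwise: `∏' f = a ≠ 0` ⇒
`∏' f⁻¹ = a⁻¹` (in `ℂ`). [folklore] -/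
private theorem hasProd_inv_of_ne_zero {ι : Type*} {f : ι → ℂ} {a : ℂ} (hf : HasProd f a)
    (ha : a ≠ 0) : HasProd (fun i => (f i)⁻¹) a⁻¹ := by
  classical
  have hT : Tendsto (fun A : Finset ι => ∏ i ∈ A, f i) atTop (𝓝 a) := hf
  have hT' := hT.inv₀ ha
  have hfun : (fun A : Finset ι => ∏ i ∈ A, (f i)⁻¹) = fun A => (∏ i ∈ A, f i)⁻¹ := by
    funext A; rw [Finset.prod_inv_distrib]
  show Tendsto (fun A : Finset ι => ∏ i ∈ A, (f i)⁻¹) atTop (𝓝 a⁻¹)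
  rw [hfun]; exact hT'

omit [NeZero D] in
/-- `Re(s + β_k) = Re s` (`β_k` is purely imaginary). [cite: Zhang2022LandauSiegel, §2 (2.13)] -/
private theorem re_add_betaJ (s : ℂ) (k : ℕ) : (s + betaJ c' D k).re = s.re := by
  rw [Complex.add_re, Section8PerronSteps.betaJ_re, add_zero]

/-- **The prefactor product**: for `σ > 1`,
`∏_q (1−χ(q)q^{−s−β_{j+1}})(1−χ(q)q^{−s−β_{j+2}})/(1−χ(q)q^{−s}) = L(s,χ)/(L(s+β_{j+1},χ)L(s+β_{j+2},χ))`
(the Euler products of the three Dirichlet `L`-functions, nonvanishing for `σ > 1`).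
[cite: Zhang2022LandauSiegel, App. A p.101] -/
theorem hasProd_pref {s : ℂ} (hs : 1 < s.re) :
    HasProd (fun q : Nat.Primes => pref c' χ j s (q : ℕ))
      (χ.LFunction s / (χ.LFunction (s + betaJ c' D (j + 1)) * χ.LFunction (s + betaJ c' D (j + 2)))) := by
  set β₁ : ℂ := betaJ c' D (j + 1) with hβ₁
  set β₂ : ℂ := betaJ c' D (j + 2) with hβ₂
  have hs1 : 1 < (s + β₁).re := by rw [hβ₁, re_add_betaJ]; exact hs
  have hs2 : 1 < (s + β₂).re := by rw [hβ₂, re_add_betaJ]; exact hs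
  have hne1 : L ↗χ (s + β₁) ≠ 0 := DirichletCharacter.LSeries_ne_zero_of_one_lt_re χ hs1
  have hne2 : L ↗χ (s + β₂) ≠ 0 := DirichletCharacter.LSeries_ne_zero_of_one_lt_re χ hs2
  have hL : HasProd (fun p : Nat.Primes => (1 - χ ((p : ℕ) : ZMod D) * (p : ℂ) ^ (-s))⁻¹) (L ↗χ s) :=
    DirichletCharacter.LSeries_eulerProduct_hasProd χ hs
  have hL1 : HasProd (fun p : Nat.Primes => 1 - χ ((p : ℕ) : ZMod D) * (p : ℂ) ^ (-(s + β₁)))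
      (L ↗χ (s + β₁))⁻¹ := by
    have h := hasProd_inv_of_ne_zero (DirichletCharacter.LSeries_eulerProduct_hasProd χ hs1) hne1
    simpa only [inv_inv] using h
  have hL2 : HasProd (fun p : Nat.Primes => 1 - χ ((p : ℕ) : ZMod D) * (p : ℂ) ^ (-(s + β₂)))
      (L ↗χ (s + β₂))⁻¹ := by
    have h := hasProd_inv_of_ne_zero (DirichletCharacter.LSeries_eulerProduct_hasProd χ hs2) hne2
    simpa only [inv_inv] using h
  have h := (hL1.mul hL2).mul hL
  have hfun : (fun q : Nat.Primes => pref c' χ j s (q : ℕ)) =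
      fun p : Nat.Primes => (1 - χ ((p : ℕ) : ZMod D) * (p : ℂ) ^ (-(s + β₁))) *
        (1 - χ ((p : ℕ) : ZMod D) * (p : ℂ) ^ (-(s + β₂))) *
          (1 - χ ((p : ℕ) : ZMod D) * (p : ℂ) ^ (-s))⁻¹ := by
    funext p; rw [pref, div_eq_mul_inv]
  have hval : χ.LFunction s / (χ.LFunction (s + β₁) * χ.LFunction (s + β₂)) =
      (L ↗χ (s + β₁))⁻¹ * (L ↗χ (s + β₂))⁻¹ * L ↗χ s := by
    rw [DirichletCharacter.LFunction_eq_LSeries χ hs, DirichletCharacter.LFunction_eq_LSeries χ hs1,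
      DirichletCharacter.LFunction_eq_LSeries χ hs2, div_eq_mul_inv, mul_inv]
    ring
  rw [hfun, hval]
  exact h

omit [NeZero D] in
/-- The Dirichlet series of Lemma 8.3 is the `L`-series of `n ↦ χ(n)ξ₀ⱼ(n;d,r)` (at `n = 0` both terms
vanish, `ξ₀ⱼ(0;d,r) = 0`). [cite: Zhang2022LandauSiegel, §8 Lemma 8.3 p.46] -/
theorem xiSeries_eq_tsum_term (d r : ℕ) (s : ℂ) :
    xiSeries c' χ j d r s = ∑' n : ℕ, term (fun n => χ (n : ZMod D) * xiZero c' D j n d r) s n := by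
  unfold xiSeries
  refine tsum_congr fun n => ?_
  rcases eq_or_ne n 0 with rfl | hn
  · rw [LSeries.term_zero, Lemma83.xiZero_apply_zero, mul_zero, zero_mul]
  · rw [LSeries.term_of_ne_zero hn, Complex.cpow_neg, div_eq_mul_inv]

/-- **`∏_q 𝔱_j(d,h,s;q) = 𝒰_j(d,h;s)` for `σ > 1`** — the Euler product of App. A §A.u004 in the
prefactor-free reading, for EVERY `D`, `χ`, `j`, `d, h ≥ 1`: `HasProd (q ↦ frakt c′ χ j d h s q)
(calU c′ χ j d h s)` over the primes (`𝔱_j = pref·(1 + λ̃·xiPowSum)`, `hasProd_pref`,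
`hasProd_chi_xiZero` with local factors `tsum_termF_prime_pow`, `HasProd.mul`).
[cite: Zhang2022LandauSiegel, App. A p.101] -/
theorem hasProd_frakt_calU {d h : ℕ} (hd : d ≠ 0) (hh : h ≠ 0) {s : ℂ} (hs : 1 < s.re) :
    HasProd (fun q : Nat.Primes => frakt c' χ j d h s (q : ℕ)) (calU c' χ j d h s) := by
  have hP := hasProd_pref c' χ j hs
  have hE := hasProd_chi_xiZero c' χ j hd hh hs
  have hloc : (fun q : Nat.Primes => ∑' e : ℕ,
      term (fun n => χ (n : ZMod D) * xiZero c' D j n d h) s ((q : ℕ) ^ e)) =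
      fun q : Nat.Primes => 1 + lamTilde c' D q (d * h) (1 - betaJ c' D j) * xiPowSum c' χ j d h s q :=
    funext fun q => tsum_termF_prime_pow c' χ j hd hh hs q.prop
  rw [hloc] at hE
  have hmul := hP.mul hE
  have hfun : (fun q : Nat.Primes => frakt c' χ j d h s (q : ℕ)) =
      fun q : Nat.Primes => pref c' χ j s (q : ℕ) *
        (1 + lamTilde c' D q (d * h) (1 - betaJ c' D j) * xiPowSum c' χ j d h s q) := by
    funext q; rfl
  have hval : calU c' χ j d h s =
      χ.LFunction s / (χ.LFunction (s + betaJ c' D (j + 1)) * χ.LFunction (s + betaJ c' D (j + 2))) *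
        ∑' n : ℕ, term (fun n => χ (n : ZMod D) * xiZero c' D j n d h) s n := by
    rw [calU, xiSeries_eq_tsum_term c' χ j d h s]
  rw [hfun, hval]
  exact hmul

end Assembly

end Literature.NumberTheory.LFunctions.Zhang2022.Lemma83

/-! ## §4. The typed node `Typed.AppendixA1.StepA_u004_read` -/

namespace Literature.NumberTheory.LFunctions.Zhang2022.Typed.AppendixA1

open Literature.NumberTheory.LFunctions.Zhang2022

/-- **Z22:§A.u004 in the PREFACTOR-FREE READING HOLDS** (`Typed.AppendixA1.StepA_u004_read c′`, App. A
p. 101 tex L4982–4986; rows G-L4t8-1 / G-d55-1): for all large `D`, every real primitive `χ (mod D)`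
under (A), `1 ≤ j ≤ 3`, `d, h ≥ 1` with `dh < PT⁻²`, and `σ > 1`, the Euler product `∏_q 𝔱_j(d,h,s;q)`
converges to `𝒰_j(d,h;s) = L(s,χ)/(L(s+β_{j+1},χ)L(s+β_{j+2},χ))·Σ_m χ(m)ξ₀ⱼ(m;d,h)m^{−s}` — in fact
for every `D ≥ 1` and every `χ`, with none of the side conditions used (`Lemma83.hasProd_frakt_calU`).
This is the `σ > 1` identification input of the App. A leaves `StepA_u007_analytic` / `StepA_u007_read`.
[cite: Zhang2022LandauSiegel, App. A p.101] -/
theorem stepA_u004_read_holds (c' : ℝ) : StepA_u004_read c' :=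
  ⟨0, fun _ _ χ _ _ _ _ j _ _ _ hd hh _ _ hs =>
    Lemma83.hasProd_frakt_calU c' χ j (Nat.one_le_iff_ne_zero.mp hd) (Nat.one_le_iff_ne_zero.mp hh) hs⟩

variable (c' : ℝ) in
/-- `StepA_u004_read` — `_holds` alias of `stepA_u004_read_holds` above under the fact's exact name, stated under the
prover's own binders as section variables (appended 2026-08-28, D-0026 bookkeeping: the proof term is the
existing theorem of this file; no statement, definition or attribute is edited; no new named fact; the
ledger's debt table listed the fact unproved). [cite: Zhang2022LandauSiegel, App. A p.101] -/
theorem _root_.Literature.NumberTheory.LFunctions.Zhang2022.Typed.AppendixA1.StepA_u004_read_holds :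
    _root_.Literature.NumberTheory.LFunctions.Zhang2022.Typed.AppendixA1.StepA_u004_read c' :=
  _root_.Literature.NumberTheory.LFunctions.Zhang2022.Typed.AppendixA1.stepA_u004_read_holds (c' := c')

end Literature.NumberTheory.LFunctions.Zhang2022.Typed.AppendixA1

end
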